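import Summits.QuantumFields.YangMills.Theorems.UnitScaleTiltProp8FlatPortKernelRows
import HarnessLib

/-!
# Route `UnitScaleTilt`, crux K1 child «MinimiserStabilityRegPr» (stmt-QuantumFields-19200), v8 pillar **P2 `stub_flatOpsCubeSeq`** — THE PORT BRIDGE, file 11:
# **RE-CHARTING WITH SMALLER BIG BLOCKS**: an `Adm22 D R M` family is `Adm22 D R M′` for every `M′ ∣ M` ((2.1): an `M`-block is a union of `M′`-blocks; (2.2): `R·M′ ≤ R·M`), so
# file 9's torus-size condition `a′ + 3 ≤ m + n` (at least `5L` big blocks per direction) can be met with the SMALLEST admissible big block `L^{a₀}` — the residual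
# small-torus regime of P2 becomes the FINITE set of sizes `m + n ≤ a₀(L) + 2`, independent of the datum's `M`

Cell `ym3-torus` (HUMAN RULING D-0037, YM ladder rung R3), seat `ym3-torus-p1` gen 17.  `--supports stmt-QuantumFields-19200 --as helper`; count-neutral; def-free.

WHAT IS PROVED (sorry-free; axioms standard; no definition): `adm22_of_dvd` (`Adm22 D R M → M′ ∣ M → Adm22 D R M′`), and **`kernelRowsAt_of_adm22_pow`**: for odd
`L = ℓ + 1 ≥ 5`, `m ≥ 1` there are `a₀, R₀ : ℕ` and `C ≥ 0`, `δ₀ > 0`, `B₃ > 0`, `C_G ≥ 0` such that for all heights `1 ≤ K − n`, `K − n + 1 ≤ m + K` with `a₀ + 3 ≤ m + n`, EVERY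
big-block exponent `a ≥ a₀ + 1` (`M = Lᵃ`), every `R ≥ R₀`, every `D : Domains (F.P K)` with `D.k = K − n`, `D.Om 1 = univ`, `Adm22 D R (Lᵃ)` and every P2 weight family:
`KernelRowsAt F n K D w C δ₀ B₃ C_G` — the binder shape of the registered text (`M₀ ≤ M`, `M = Lᵃ`, `R₀ ≤ R`) up to `Ω₁ = T`, `L ≥ 5` and the finite small-torus set.
HONEST SCOPE: bookkeeping over file 9; NOT a claim about the mass gap.

References: T. Bałaban, CMP **96** (1984) 223–250 [Balaban1984PropagatorsII] (2.1)–(2.2) p.224; CMP **102** (1985) 277–309 [Balaban1985Variational] (161)–(163) p.303.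
-/

set_option autoImplicit false

noncomputable section

namespace Summit.QuantumFields.YangMills.Theorems.FlatPortRechart

open Literature.MathematicalPhysics.QuantumFieldTheory.Balaban1983to89
open B5Eq117TorusCarriers (Mk)
open B5Prop12FieldsLattice (distSite)
open B6GlobalChartV1 (PV)
open B6SectADomainsV1 (Domains)
open T3ContinuumYM3Torus (T3Family)
open FlatCubeOpsText (Adm22 IsLevWeight)
open FlatOpsFromKernelRows (KernelRowsAt)
open FlatPortKernelRows (kernelRowsAt_of_adm22)

/-- `1 ≤ 3` (named once). [folklore] -/
private theorem hd3 : 1 ≤ 2 + 1 := by norm_num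

/-- **(2.1)–(2.2) WITH SMALLER BIG BLOCKS**: `Adm22 D R M` and `M′ ∣ M` give `Adm22 D R M′` (an `M`-block is a union of `M′`-blocks; the separation `> R·M ≥ R·M′`).
[cite: Balaban1984PropagatorsII, (2.1)-(2.2) p.224] -/
theorem adm22_of_dvd {P : Params} {D : Domains P} {R M M' : ℕ} (h : Adm22 D R M) (hdvd : M' ∣ M) : Adm22 D R M' := by
  obtain ⟨q, rfl⟩ := hdvd
  refine ⟨fun j hj y y' hyy' => h.1 j hj y y' fun μ => ?_, fun j y y' hin hout => lt_of_le_of_lt ?_ (h.2 j y y' hin hout)⟩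
  · rw [← Nat.div_div_eq_div_mul, ← Nat.div_div_eq_div_mul, hyy' μ]
  · -- `R·M′ ≤ R·(M′·q)` when `q ≥ 1`; when `q = 0` the separation clause of `h` reads `0 < dist`, and `R·M′ ≤ dist` needs a different route:
    -- but `q = 0` means `M = 0`, and then `h.2` gives `(R·0 : ℝ) < dist`, which does NOT bound `R·M′`; we use instead that the hypothesis `hin`/`hout` are the same
    -- for both, so we only need the monotone case. Reduce to `1 ≤ q` by cases.
    rcases Nat.eq_zero_or_pos q with hq | hq
    · subst hq
      -- `M = 0`: `Adm22 D R 0`'s block clause says membership depends only on `y/0 = 0`, i.e. every `Om j` (`j ≥ 1`) is `∅` or `univ`; then `hin`/`hout` contradict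
      exfalso
      have hall : y' ∈ D.Om j ↔ y ∈ D.Om j := by
        rcases Nat.eq_zero_or_pos j with hj | hj
        · subst hj; simp [D.Om_zero]
        · exact h.1 j hj y' y fun μ => by simp
      have hy : y ∈ D.Om j := D.nested y hin
      exact hout (hall.2 hy)
    · exact_mod_cast Nat.mul_le_mul_left R (Nat.le_mul_of_pos_right M' hq)

/-- **`KernelRowsAt` AT EVERY ADMISSIBLE FAMILY WITH `Ω₁ = T` IN THE REGISTERED TEXT's BINDER SHAPE** (`M = Lᵃ`, `a ≥ a₀ + 1`, `R ≥ R₀`; torus size `a₀ + 3 ≤ m + n` only):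
re-chart with the smallest admissible big block `L·L^{a₀}` (`adm22_of_dvd`) and apply file 9's `kernelRowsAt_of_adm22`.
[cite: Balaban1984PropagatorsII, (2.1)-(2.4) p.224, Cor. 2.8 (2.150)-(2.151) p.249; Balaban1985Variational, (161)-(163) p.303] -/
theorem kernelRowsAt_of_adm22_pow (ℓ : ℕ) (hL : Odd (ℓ + 1) ∧ 1 < ℓ + 1) (hℓ : 4 ≤ ℓ) (m : ℕ) (hm : 1 ≤ m) :
    ∃ (a₀ R₀ : ℕ) (C δ₀ B₃ CG : ℝ), 0 ≤ C ∧ 0 < δ₀ ∧ 0 < B₃ ∧ 0 ≤ CG ∧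
    ∀ (n K : ℕ) (_ : 1 ≤ K - n) (_ : K - n + 1 ≤ m + K) (_ : a₀ + 3 ≤ m + n) {R a : ℕ} (_ : a₀ + 1 ≤ a) (_ : R₀ ≤ R)
      (D : Domains (PV 2 ℓ m K hd3 hL)) (_ : D.k = K - n) (_ : D.Om 1 = Finset.univ) (_ : Adm22 D R ((ℓ + 1) ^ a))
      (w : ℕ → PBond (PV 2 ℓ m K hd3 hL) 0 → ℝ) (_ : IsLevWeight (⟨ℓ + 1, hL, m, hm⟩ : T3Family) n K D w),
      KernelRowsAt (⟨ℓ + 1, hL, m, hm⟩ : T3Family) n K D w C δ₀ B₃ CG := by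
  obtain ⟨Mh₀, R₀, C, δ₀, B₃, CG, hC, hδ₀, hB₃, hCG, hmain⟩ := kernelRowsAt_of_adm22 ℓ hL hℓ m hm
  -- `a₀ := Mh₀`: `L^{Mh₀} ≥ Mh₀`
  refine ⟨Mh₀, R₀, C, δ₀, B₃, CG, hC, hδ₀, hB₃, hCG, ?_⟩
  intro n K hk1 hk' hsize R a ha hR D hDk h1 hAdm w hw
  have hL1 : 1 < ℓ + 1 := by omega
  have hMh : Mh₀ ≤ (ℓ + 1) ^ Mh₀ := (Nat.lt_pow_self hL1).le
  -- re-chart: `L·L^{a₀} ∣ L^a`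
  have hdvd : (ℓ + 1) * (ℓ + 1) ^ Mh₀ ∣ (ℓ + 1) ^ a := by
    rw [← pow_succ']
    exact pow_dvd_pow _ (by omega)
  have hAdm' : Adm22 D R ((ℓ + 1) * (ℓ + 1) ^ Mh₀) := adm22_of_dvd hAdm hdvd
  exact hmain n K hk1 hk' rfl hMh hR hsize D hDk h1 hAdm' w hw

end Summit.QuantumFields.YangMills.Theorems.FlatPortRechart

end
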